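import Summits.BirchSwinnertonDyer.Rank1Residual.GaloisImage.KolyvaginPrimeLocalShape
import Literature.NumberTheory.GaloisRepresentations.ContinuousH1TrivialAction
import HarnessLib

/-!
# T1 JET (cell `bsd-jet`), road K, input (L1) — brick E (generic local algebra): for a TRIVIAL
# finite Galois module `W` of a local field, `H¹_ur(F, W) ≅ W` by evaluation at a Frobenius, and
# the eigenspaces of a "compatible-pair" endomorphism of `H¹` are counted on `W`

HONEST FRAMING (programme file `BSD-LIT2PART-PROGRAMME-v1.md` §HONESTY, verbatim): «no tranche here
proves BSD; ARM L moves the LITERAL column of an r ≤ 1 census into the kernel-proved-modulo-named-print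
column; ARM P changes what «named print» is worth.» THEOREMS ONLY (seat `bsd-jet-pv-1`, session g6;
`--supports stmt-BirchSwinnertonDyer-14418`, helper): no definition, no named fact, no `sorry`.
Nothing is booked; 0 classes move.

## What

`F` a non-archimedean local field, `W` a finite discrete `Γ_F`-module on which `Γ_F` acts
TRIVIALLY (at a Kolyvagin prime `λ` of `K`: `W = E[p^k]`, `F = K_λ`, brick C), `φ` an arithmetic
Frobenius. Then `H¹(F, W) = Hom_cont(Γ_F, W)` (no coboundaries) and:
* `apply_eq_zero_of_unramified_of_apply_frob_eq_zero` — an unramified continuous homomorphism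
  `ψ : Γ_F → W` (`ψ|_{I_F} = 0`) with `ψ(φ) = 0` is `0` (`Γ_F/U` is generated by `φ` for every open
  normal `U ⊇ I_F`, tree `exists_pow_eq_mk`);
* `apply_eq_apply_of_isFrobPow` — such a `ψ` takes the same value on all Frobenius elements;
* **`natCard_unramifiedSubgroup_inf_ker_eq_natCard_ker`** — for an endomorphism `T` of `H¹(F, W)`
  given on cocycles by `[ψ] ↦ [g ↦ t(ψ(f g))]` with `t : W →+ W`, `f : Γ_F → Γ_F` carrying
  Frobenius to Frobenius and inertia to inertia (the shape of `conjActPlace`/`localConjH1`: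
  `f = Θ⁻¹(·)Θ`, `t = τ̃_*`), and any `s : ℤ`:
  `#(H¹_ur(F, W) ∩ ker(T − s)) = #ker(t − s | W)` — evaluation at `φ` is a bijection
  `H¹_ur ≅ W` (injective by the first bullet, `#H¹_ur = #W^{Γ_F} = #W` by n1011's
  `natCard_unramifiedSubgroup_eq_natCard_invariants`) matching the two eigen-conditions.
This is Jetchev 2008 §3.2 (2) «`H¹_f(K_λ, E[p^k]) ≅ E[p^k]/(Frob_λ − 1) = E[p^k]` with `τ` acting
through its action on `E[p^k]`» in the tree's cocycle model; consumers: bricks D/F of `hloc`.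

References (locators only; no cited FACT is declared): [cite: Jetchev2008, §3.2 (2) (p. 815)]
[cite: Rubin2011, Prop. 1.4.13 (1) (p. 9)] [cite: MilneADT2006, Ch. I, Lemma 2.9]
[cite: SerreGaloisCohomology1997, I §2.3]. Design: no definitions; generic in `F`, `W`. Axioms:
`propext`, `Classical.choice`, `Quot.sound`.
-/

set_option autoImplicit false

noncomputable section

open scoped Classical
open Function Field
open Literature.NumberTheory.GaloisRepresentations
open Literature.NumberTheory.GaloisRepresentations.IsNonarchimedeanLocalField
open _root_.TopRep _root_.ContinuousCohomology

universe u

namespace Summit.BirchSwinnertonDyer.Rank1Residual.JET.GlobalDuality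

section TrivialLocal

variable {F : Type u} [Field F] [ValuativeRel F] [TopologicalSpace F] [IsNonarchimedeanLocalField F]
variable {W : Type u} [AddCommGroup W] [TopologicalSpace W] [DiscreteTopology W]
  (ρ : DiscreteGaloisModule F W)

/-- **An unramified continuous homomorphism vanishing at a Frobenius is zero** (trivial action):
its kernel `U` is an open normal subgroup containing `I_F` and `φ`, and `Γ_F/U` is generated by the
image of `φ` (`exists_pow_eq_mk`). [cite: SerreLocalFields1979, Ch. XIII §1]
[cite: Rubin2011, Prop. 1.4.13 (1) (p. 9)] -/
theorem apply_eq_zero_of_unramified_of_apply_frob_eq_zero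
    (htriv : ∀ (g : absoluteGaloisGroup F) (w : W), ρ g w = w)
    {φ : absoluteGaloisGroup F} (hφ : IsFrobPow φ 1) (ψ : contOneCocycles ρ.toTopRep)
    (hI : ∀ τ ∈ absInertia F, ψ.1 τ = 0) (hφ0 : ψ.1 φ = 0) (g : absoluteGaloisGroup F) :
    ψ.1 g = 0 := by
  have hmul : ∀ a b, ψ.1 (a * b) = ψ.1 a + ψ.1 b :=
    contOneCocycles.apply_mul_of_trivial (X := ρ.toTopRep) htriv ψ
  have hone : ψ.1 1 = 0 := contOneCocycles.apply_one ψ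
  have hinv : ∀ a, ψ.1 a⁻¹ = -ψ.1 a := fun a => by
    rw [eq_neg_iff_add_eq_zero, ← hmul, inv_mul_cancel, hone]
  -- the kernel of `ψ`, an open normal subgroup containing `I_F`
  let U : Subgroup (absoluteGaloisGroup F) :=
    { carrier := {a | ψ.1 a = 0}
      one_mem' := hone
      mul_mem' := fun {a b} ha hb => by
        change ψ.1 (a * b) = 0
        rw [hmul, ha, hb, add_zero]
      inv_mem' := fun {a} ha => by
        change ψ.1 a⁻¹ = 0
        rw [hinv, ha, neg_zero] }
  have hUmem : ∀ {a}, a ∈ U ↔ ψ.1 a = 0 := fun {a} => Iff.rfl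
  haveI : U.Normal := ⟨fun a ha b => by
    rw [hUmem] at ha ⊢
    rw [hmul, hmul, ha, add_zero, hinv, add_neg_cancel]⟩
  have hUo : IsOpen (U : Set (absoluteGaloisGroup F)) :=
    (isOpen_discrete ({0} : Set W)).preimage ψ.1.continuous
  have hIU : absInertia F ≤ U := fun τ hτ => hI τ hτ
  obtain ⟨i, hi⟩ := exists_pow_eq_mk F hUo hIU hφ (QuotientGroup.mk g)
  rw [← QuotientGroup.mk_pow, QuotientGroup.eq, hUmem, hmul, hinv] at hi
  -- `hi : -ψ g + ψ (φ ^ i) = 0`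
  have hpow : ∀ j : ℕ, ψ.1 (φ ^ j) = 0 := fun j => by
    induction j with
    | zero => rw [pow_zero, hone]
    | succ j ih => rw [pow_succ, hmul, ih, hφ0, add_zero]
  rw [hpow, add_zero, neg_eq_zero] at hi
  exact hi

/-- **An unramified continuous homomorphism takes the same value on all arithmetic Frobenius
elements** (trivial action): two Frobenius powers of exponent `1` differ by an element of `I_F`.
[cite: SerreLocalFields1979, Ch. XIII §1] -/
theorem apply_eq_apply_of_isFrobPow (htriv : ∀ (g : absoluteGaloisGroup F) (w : W), ρ g w = w)
    {φ φ' : absoluteGaloisGroup F} (hφ : IsFrobPow φ 1) (hφ' : IsFrobPow φ' 1)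
    (ψ : contOneCocycles ρ.toTopRep) (hI : ∀ τ ∈ absInertia F, ψ.1 τ = 0) :
    ψ.1 φ' = ψ.1 φ := by
  have hmul : ∀ a b, ψ.1 (a * b) = ψ.1 a + ψ.1 b :=
    contOneCocycles.apply_mul_of_trivial (X := ρ.toTopRep) htriv ψ
  have hmem : φ' * φ⁻¹ ∈ absInertia F := IsFrobPow.mul_inv_mem_absInertia_holds hφ' hφ
  have h := hI _ hmem
  have e : φ' = φ' * φ⁻¹ * φ := by rw [inv_mul_cancel_right]
  rw [e, hmul, h, zero_add]

variable [Finite W]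

/-- **Eigenspaces of a compatible-pair endomorphism of `H¹(F, W)` on the unramified classes are
counted on `W`** (trivial action). Let `T : H¹ → H¹` be given on cocycles by
`[ψ] ↦ [g ↦ t(ψ(f g))]` (`t : W →+ W`, `f : Γ_F → Γ_F` sending an arithmetic Frobenius `φ` to an
arithmetic Frobenius and `I_F` into `I_F`). Then for every `s : ℤ`,
`#(H¹_ur(F, W) ∩ ker(T − s)) = #ker(t − s)`: evaluation at `φ` is a bijection `H¹_ur(F, W) ≅ W`
(`H¹ = Hom`, injective by `apply_eq_zero_of_unramified_of_apply_frob_eq_zero`, and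
`#H¹_ur = #W^{Γ_F} = #W`, n1011 `natCard_unramifiedSubgroup_eq_natCard_invariants`), under which
`T` becomes `t` (`ψ(f φ) = ψ(φ)`). Jetchev 2008 §3.2 (2): on `H¹_f(K_λ, E[p^k]) ≅ E[p^k]`
complex conjugation acts through `E[p^k]`. [cite: Jetchev2008, §3.2 (2) (p. 815)]
[cite: Rubin2011, Prop. 1.4.13 (1) (p. 9)] -/
theorem natCard_unramifiedSubgroup_inf_ker_eq_natCard_ker
    (htriv : ∀ (g : absoluteGaloisGroup F) (w : W), ρ g w = w)
    {φ : absoluteGaloisGroup F} (hφ : IsFrobPow φ 1)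
    (T : galoisCohomology ρ 1 →+ galoisCohomology ρ 1) (t : W →+ W)
    (f : absoluteGaloisGroup F → absoluteGaloisGroup F)
    (hT : ∀ ψ : contOneCocycles ρ.toTopRep, ∃ ψ' : contOneCocycles ρ.toTopRep,
      T (oneCocycleClass ρ.toTopRep ψ) = oneCocycleClass ρ.toTopRep ψ' ∧
        ∀ g, ψ'.1 g = t (ψ.1 (f g)))
    (hf : IsFrobPow (f φ) 1) (hfI : ∀ τ ∈ absInertia F, f τ ∈ absInertia F) (s : ℤ) :
    Nat.card ↥(DiscreteGaloisModule.unramifiedSubgroup ρ 1 ⊓ (T - s • AddMonoidHom.id _).ker) =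
      Nat.card (t - s • AddMonoidHom.id W).ker := by
  have hinj : Injective (oneCocycleClass ρ.toTopRep) := oneCocycleClass_injective_of_trivial ρ.toTopRep htriv
  have hI : ∀ τ ∈ absInertia F, ∀ w : W, ρ τ w = w := fun τ _ w => htriv τ w
  -- the representing cocycle of a class (unique: trivial action)
  have hrep : ∀ c : galoisCohomology ρ 1, ∃ ψ : contOneCocycles ρ.toTopRep, oneCocycleClass ρ.toTopRep ψ = c :=
    fun c => oneCocycleClass_surjective ρ.toTopRep c
  choose rep hrep using hrep
  have hrep_class : ∀ ψ : contOneCocycles ρ.toTopRep, rep (oneCocycleClass ρ.toTopRep ψ) = ψ :=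
    fun ψ => hinj (hrep _)
  -- unramified classes: cocycles vanishing on `I_F`
  have hur : ∀ c : galoisCohomology ρ 1, c ∈ DiscreteGaloisModule.unramifiedSubgroup ρ 1 ↔
      ∀ τ ∈ absInertia F, (rep c).1 τ = 0 := fun c => by
    conv_lhs => rw [← hrep c]
    exact X11b.LocBridge.mem_unramifiedSubgroup_one_iff_forall_eq_zero ρ hI (rep c)
  -- cocycle arithmetic
  have hsub : ∀ (ψ₁ ψ₂ : contOneCocycles ρ.toTopRep) (g), (ψ₁ - ψ₂).1 g = ψ₁.1 g - ψ₂.1 g :=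
    fun ψ₁ ψ₂ g => by rw [Submodule.coe_sub, ContinuousMap.sub_apply]
  have hzsmul : ∀ (ψ : contOneCocycles ρ.toTopRep) (g), (s • ψ).1 g = s • ψ.1 g :=
    fun ψ g => by rw [Submodule.coe_smul_of_tower, ContinuousMap.coe_smul, Pi.smul_apply]
  have hclass_zsmul : ∀ ψ : contOneCocycles ρ.toTopRep,
      (oneCocycleClass ρ.toTopRep (s • ψ) : galoisCohomology ρ 1) =
        s • (oneCocycleClass ρ.toTopRep ψ : galoisCohomology ρ 1) :=
    fun ψ => map_zsmul (oneCocycleClassₗ ρ.toTopRep) s ψ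
  -- ### evaluation at `φ` is injective on unramified classes
  have hev_inj : ∀ c₁ c₂ : galoisCohomology ρ 1,
      c₁ ∈ DiscreteGaloisModule.unramifiedSubgroup ρ 1 → c₂ ∈ DiscreteGaloisModule.unramifiedSubgroup ρ 1 →
      (rep c₁).1 φ = (rep c₂).1 φ → c₁ = c₂ := by
    intro c₁ c₂ h₁ h₂ h
    have hz : ∀ g, (rep c₁ - rep c₂).1 g = 0 :=
      apply_eq_zero_of_unramified_of_apply_frob_eq_zero ρ htriv hφ (rep c₁ - rep c₂)
        (fun τ hτ => by rw [hsub, (hur c₁).mp h₁ τ hτ, (hur c₂).mp h₂ τ hτ, sub_zero])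
        (by rw [hsub, h, sub_self])
    have heq : rep c₁ = rep c₂ := by
      apply Subtype.ext; ext g
      exact sub_eq_zero.mp ((hsub _ _ g).symm.trans (hz g))
    rw [← hrep c₁, ← hrep c₂, heq]
  -- ### and hence bijective onto `W` (`#H¹_ur = #W`)
  have hcard : Nat.card (DiscreteGaloisModule.unramifiedSubgroup ρ 1) = Nat.card W := by
    rw [GaloisImage.natCard_unramifiedSubgroup_eq_natCard_invariants ρ hI]
    exact Nat.card_congr
      { toFun := fun x => x.1
        invFun := fun w => ⟨w, fun g => htriv g w⟩
        left_inv := fun _ => rfl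
        right_inv := fun _ => rfl }
  haveI : Finite (DiscreteGaloisModule.unramifiedSubgroup ρ 1) :=
    Nat.finite_of_card_ne_zero (by rw [hcard]; exact Nat.card_pos.ne')
  let ev : DiscreteGaloisModule.unramifiedSubgroup ρ 1 → W := fun c => (rep c.1).1 φ
  have hev_bij : Bijective ev := by
    rw [Nat.bijective_iff_injective_and_card]
    exact ⟨fun c₁ c₂ h => Subtype.ext (hev_inj _ _ c₁.2 c₂.2 h), hcard⟩
  -- ### the eigen-condition on a class is the eigen-condition on its value at `φ`
  have hmemker : ∀ {c : galoisCohomology ρ 1}, c ∈ (T - s • AddMonoidHom.id _).ker ↔ T c = s • c :=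
    fun {c} => by
      rw [AddMonoidHom.mem_ker, AddMonoidHom.sub_apply, AddMonoidHom.smul_apply, AddMonoidHom.id_apply,
        sub_eq_zero]
  have hmemkert : ∀ {w : W}, w ∈ (t - s • AddMonoidHom.id W).ker ↔ t w = s • w := fun {w} => by
    rw [AddMonoidHom.mem_ker, AddMonoidHom.sub_apply, AddMonoidHom.smul_apply, AddMonoidHom.id_apply,
      sub_eq_zero]
  have key : ∀ c : galoisCohomology ρ 1, c ∈ DiscreteGaloisModule.unramifiedSubgroup ρ 1 →
      (T c = s • c ↔ t ((rep c).1 φ) = s • (rep c).1 φ) := by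
    intro c hc
    obtain ⟨ψ', hTψ, hψ'⟩ := hT (rep c)
    rw [hrep] at hTψ
    have hcur : ∀ τ ∈ absInertia F, (rep c).1 τ = 0 := (hur c).mp hc
    -- `ψ'` and `s • rep c` are unramified cocycles
    have hψ'I : ∀ τ ∈ absInertia F, ψ'.1 τ = 0 := fun τ hτ => by
      rw [hψ', hcur _ (hfI τ hτ), map_zero]
    have hsI : ∀ τ ∈ absInertia F, (s • rep c).1 τ = 0 := fun τ hτ => by
      rw [hzsmul, hcur τ hτ, smul_zero]
    -- value of `ψ'` at `φ`
    have hval : ψ'.1 φ = t ((rep c).1 φ) := by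
      rw [hψ', apply_eq_apply_of_isFrobPow ρ htriv hφ hf (rep c) hcur]
    constructor
    · intro h
      -- `[ψ'] = [s • rep c]`, so `ψ' = s • rep c`
      have h1 : oneCocycleClass ρ.toTopRep ψ' = oneCocycleClass ρ.toTopRep (s • rep c) := by
        rw [hclass_zsmul, hrep, ← hTψ]; exact h
      have h2 : ψ' = s • rep c := hinj h1
      rw [← hval, h2, hzsmul]
    · intro h
      -- `ψ' − s • rep c` is unramified and vanishes at `φ`, hence is `0`
      have hz : ∀ g, (ψ' - s • rep c).1 g = 0 :=
        apply_eq_zero_of_unramified_of_apply_frob_eq_zero ρ htriv hφ (ψ' - s • rep c)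
          (fun τ hτ => by rw [hsub, hψ'I τ hτ, hsI τ hτ, sub_zero])
          (by rw [hsub, hval, h, hzsmul, sub_self])
      have heq : ψ' = s • rep c := by
        apply Subtype.ext; ext g
        exact sub_eq_zero.mp ((hsub _ _ g).symm.trans (hz g))
      rw [hTψ, heq, hclass_zsmul, hrep]
      exact (int_smul_eq_zsmul _ s c).trans (int_smul_eq_zsmul _ s c).symm
  -- ### assemble: `ev` restricts to a bijection of the eigen-parts
  refine Nat.card_congr (Equiv.ofBijective
    (fun c : ↥(DiscreteGaloisModule.unramifiedSubgroup ρ 1 ⊓ (T - s • AddMonoidHom.id _).ker) =>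
      (⟨(rep c.1).1 φ, hmemkert.mpr ((key c.1 c.2.1).mp (hmemker.mp c.2.2))⟩ :
        (t - s • AddMonoidHom.id W).ker)) ⟨fun c₁ c₂ h => ?_, fun w => ?_⟩)
  · exact Subtype.ext (hev_inj _ _ c₁.2.1 c₂.2.1 (congrArg Subtype.val h))
  · obtain ⟨c, hc⟩ := hev_bij.2 (w : W)
    refine ⟨⟨c.1, c.2, hmemker.mpr ((key c.1 c.2).mpr ?_)⟩, Subtype.ext hc⟩
    have hw := hmemkert.mp w.2
    change (rep c.1).1 φ = (w : W) at hc
    rw [hc]; exact hw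

end TrivialLocal

end Summit.BirchSwinnertonDyer.Rank1Residual.JET.GlobalDuality

end
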